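/-
Copyright (c) 2026 the pub-hodgecm-mathlib formalisation cell (harness21).  Prover seat hodgecm-mathlib-K2E3-p31 (g3) on S4 dealer K2E2-plan (g7)'s NEW DEAL
2026-09-05T02:00:29Z, Track B «K2-LIT», R90-TF section S4 (h413 = `stmt-HodgeConjecture-24833`), T-WIF road, (B1-Σ) input: «`γ ↦ Φ^{st}_ε(sec₀ γ, φ) · β(sec₀ γ)` IS A
STABLE CLASS FUNCTION ON `G_v`» — the `hG` letter of ★ `setIntegral_cartanWeight_smul_eq_of_transport` (R90-C131-p03 (g3)'s (B1-Σ) assembly).  THEOREMS ONLY (no `def`,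
no `instance`, no notation, no named-fact hypothesis, no `sorry`); ★-only imports.
-/
import Summits.HodgeConjecture.HodgeConjecture.Theorems.R90S4TwistedWeylSectionIndep     -- ★ (K2E3-p12): `stableEpsOrbitalIntegral_congr_of_isStablyEpsConjAt` (the ε-side: `Φ^{st}_ε(·, φ)` is a stable ε-class function); brings ★ `R90S4TwistedTransferDefs`
import Summits.HodgeConjecture.HodgeConjecture.Theorems.R90S4NormStableClassBijection     -- ★ p863074 (R90-C131-p03): `isStablyEpsConjAt_iff_isStablyConjGAt` (Prop. 3.11.1 (c): `δ ∼_{ε-st} δ′ ↔ γ ∼_{st} γ′` along norms)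
import Summits.HodgeConjecture.HodgeConjecture.Theorems.R90S4StableTransportDict        -- ★ p863911 (K2E3-p12): `setIntegral_cartanWeight_smul_eq_of_transport` (its `hG` letter is paid here); brings `cartanWeight`, `Gqs`
import HarnessLib

/-!
# R90-TF · S4 «Ch. 13.1–2», T-WIF road, (B1-Σ) input — THE TORUS-SIDE INTEGRAND `γ ↦ Φ^{st}_ε(sec₀ γ, φ) · β(sec₀ γ)` OF THE TWISTED WEYL FORMULA IS A STABLE CLASS
# FUNCTION ON `G_v` (Rogawski 1990, §12.5 p. 186; §3.11 Prop. 3.11.1 (c) p. 34; §4.10 (4.10.1) p. 57)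

Cell `hodgecm-mathlib`, crux H413 (`stmt-HodgeConjecture-24833`, lane `--supports … --as helper`), route of record `HCCMUnconditional` (no route verbs;
count-neutral).  Programme R90-TF, section S4 = [Rogawski1990] Ch. 13.1–13.2; S4 dealer K2E2-plan (g7), NEW DEAL 2026-09-05T02:00:29Z to this seat; consumer
R90-C131-p03 (g3)'s (B1-Σ) `R90S4TwistedWeylMeasureOfTubeJacobians` (census `R90/R90-C131-p03/g3/CENSUS-B1-assembly.md` §4: «transport of every member to its
representative (★ `setIntegral_cartanWeight_smul_eq_of_transport`, `G := Φ^{st}_ε(sec₀ ·, φ) β(sec₀ ·)` is a STABLE class function on `G_v`)»).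

THE POINT.  ★ `R90S4StableTransportDict.setIntegral_cartanWeight_smul_eq_of_transport` (p863911 :160–:166) moves the weighted torus integral of a function
`G : G_v → E` from a Cartan member `T` to a stably conjugate member `T′` provided `hG : ∀ γ γ′, IsStablyConjGAt γ γ′ → G γ = G γ′`.  In the (B1-Σ) assembly
`G γ = Φ^{st}_ε(sec₀ γ, φ) · β(sec₀ γ)` for an everywhere-norm section `sec₀` (`γ ∈ 𝒩(sec₀ γ)`, ★ `exists_normSection`) and a continuous ε-stable class function `β`
(★ `IsTwistedWeylMeasure`'s hypothesis bytes `∀ δ δ′, IsStablyEpsConjAt δ δ′ → β δ = β δ′`).  Its `hG` is two ★ facts composed: Prop. 3.11.1 (c) ★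
`isStablyEpsConjAt_iff_isStablyConjGAt` (`γ ∼_{st} γ′` with `γ ∈ 𝒩(sec₀ γ)`, `γ′ ∈ 𝒩(sec₀ γ′)` ⇒ `sec₀ γ ∼_{ε-st} sec₀ γ′`) and ★
`stableEpsOrbitalIntegral_congr_of_isStablyEpsConjAt` (`Φ^{st}_ε(·, φ)` is a function of the stable ε-class — it is DEFINED as the `finsum` of the twisted class orbital
integrals over the ε-classes inside the stable ε-class, (4.10.1)).  No measure theory; generic in a (not necessarily hermitian) form `Φ : GL₃(L)`, then packaged at the
form of record `Φ := splitFormGL L` on the carrier `Gqs L v` in ★ :166's exact binder shape.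
* §1 `isStablyEpsConjAt_normSection_of_isStablyConjGAt` (`γ ∼_{st} γ′ ⇒ sec₀ γ ∼_{ε-st} sec₀ γ′`); `stableEpsOrbitalIntegral_normSection_eq_of_isStablyConjGAt`
  (`Φ^{st}_ε(sec₀ γ, φ) = Φ^{st}_ε(sec₀ γ′, φ)`); **`stableEpsOrbitalIntegral_mul_eq_of_isStablyConjGAt`** (with `β`); `stableEpsOrbitalIntegral_smul_eq_of_isStablyConjGAt`
  (`E`-valued `•` variant).
* §2 AT THE FORM OF RECORD: **`stableEpsOrbitalIntegral_mul_eq_of_isStablyConjGAt_gqs`** — the `hG` row VERBATIM in ★ :166's shape for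
  `G := fun γ => stableEpsOrbitalIntegral L (splitFormGL L) v mGt φ (sec₀ γ) * β (sec₀ γ)` (+ `•` variant); and the instantiated transport
  **`setIntegral_cartanWeight_smul_stableEpsOrbitalIntegral_mul_eq_of_transport`** (★ :160 with `hG` discharged: the (B1-Σ) step «move every member to its representative»).

HONEST LABEL: HC_CM is proved only modulo the 7 printed citations (2 remaining named inputs: hLiu418 = stmt-HodgeConjecture-24832, h413 =
stmt-HodgeConjecture-24833) until rung 0 closes.  A class-function lemma; it pays the `hG` input of one (B1-Σ) step and no socket ((B1) ∕ (W-NP) OPEN; REL ≠ ★ ≠ BUILT).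

[cite: Rogawski1990, §12.5 p. 186; §3.11 Prop. 3.11.1 (c) p. 34; §4.10 (4.10.1) p. 57; §4.3 (4.3.1) p. 43]
-/

set_option autoImplicit false
-- the mandated namespace repeats the single-problem summit's segment (`HodgeConjecture.HodgeConjecture`)
set_option linter.dupNamespace false

noncomputable section

open MeasureTheory Measure Set NumberField IsDedekindDomain
open scoped ENNReal NNReal MatrixGroups

namespace Summit.HodgeConjecture.HodgeConjecture.R90.S4

open Literature.NumberTheory.Rogawski1990 Literature.NumberTheory.Rogawski1990.Ch4Sec10
open Literature.NumberTheory.Automorphic Literature.NumberTheory.Automorphic.UnitaryGroup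

/-! ## §1 Generic form `Φ`: the torus-side integrand is a stable class function on `G_v` -/

section Generic

variable {L : Type} [Field L] [NumberField L] [IsCMField L] {Φ : GL (Fin 3) L} {v : HeightOneSpectrum (𝓞 ↥(maximalRealSubfield L))}

/-- **`γ ∼_{st} γ′ ⇒ sec₀ γ ∼_{ε-st} sec₀ γ′`** for an everywhere-norm section `sec₀` (`γ ∈ 𝒩(sec₀ γ)` for all `γ`): Prop. 3.11.1 (c) ★ `isStablyEpsConjAt_iff_isStablyConjGAt`
read from right to left. [cite: Rogawski1990, §3.11 Prop. 3.11.1 (c) p. 34] -/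
theorem isStablyEpsConjAt_normSection_of_isStablyConjGAt
    {sec₀ : (UnitaryGroup.cmDatum L 3 (Φ : Matrix (Fin 3) (Fin 3) L)).Local v → GtLoc L v} (hsec : ∀ γ, IsEpsNormPair L Φ v (sec₀ γ) γ)
    {γ γ' : (UnitaryGroup.cmDatum L 3 (Φ : Matrix (Fin 3) (Fin 3) L)).Local v} (hst : IsStablyConjGAt L Φ v γ γ') :
    IsStablyEpsConjAt L Φ v (sec₀ γ) (sec₀ γ') :=
  (isStablyEpsConjAt_iff_isStablyConjGAt (hsec γ) (hsec γ')).2 hst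

variable [∀ δ : GtLoc L v, MeasurableSpace (GtLoc L v ⧸ epsCentralizer (epsLoc L Φ v) δ)]

/-- **`Φ^{st}_ε(sec₀ γ, φ) = Φ^{st}_ε(sec₀ γ′, φ)` for stably conjugate `γ, γ′ ∈ G_v`** (`sec₀` an everywhere-norm section): §1's stable ε-conjugacy of the sections + ★
`stableEpsOrbitalIntegral_congr_of_isStablyEpsConjAt` (`Φ^{st}_ε(·, φ)` only sees the stable ε-class, (4.10.1)).
[cite: Rogawski1990, §4.10 (4.10.1) p. 57; §3.11 Prop. 3.11.1 (c) p. 34; §12.5 p. 186] -/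
theorem stableEpsOrbitalIntegral_normSection_eq_of_isStablyConjGAt (mGt : EpsOrbitalMeasureFamily (epsLoc L Φ v) ⊥) (φ : GtLoc L v → ℂ)
    {sec₀ : (UnitaryGroup.cmDatum L 3 (Φ : Matrix (Fin 3) (Fin 3) L)).Local v → GtLoc L v} (hsec : ∀ γ, IsEpsNormPair L Φ v (sec₀ γ) γ)
    {γ γ' : (UnitaryGroup.cmDatum L 3 (Φ : Matrix (Fin 3) (Fin 3) L)).Local v} (hst : IsStablyConjGAt L Φ v γ γ') :
    stableEpsOrbitalIntegral L Φ v mGt φ (sec₀ γ) = stableEpsOrbitalIntegral L Φ v mGt φ (sec₀ γ') :=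
  stableEpsOrbitalIntegral_congr_of_isStablyEpsConjAt (isStablyEpsConjAt_normSection_of_isStablyConjGAt hsec hst) mGt φ

/-- **THE TORUS-SIDE INTEGRAND IS A STABLE CLASS FUNCTION ON `G_v`**: for an ε-stable class function `β` (★ `IsTwistedWeylMeasure`'s hypothesis bytes
`∀ δ δ′, IsStablyEpsConjAt δ δ′ → β δ = β δ′`) and an everywhere-norm section `sec₀`, `γ ∼_{st} γ′ ⇒ Φ^{st}_ε(sec₀ γ, φ) · β(sec₀ γ) = Φ^{st}_ε(sec₀ γ′, φ) · β(sec₀ γ′)`.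
Print: the integrand `Φ^{st}_ε(δ, φ) α(δ)` of the twisted Weyl formula is a function of `N(δ)` up to stable conjugacy (p. 186, «`α` a stable ε-class function»).
[cite: Rogawski1990, §12.5 p. 186; §3.11 Prop. 3.11.1 (c) p. 34; §4.10 (4.10.1) p. 57] -/
theorem stableEpsOrbitalIntegral_mul_eq_of_isStablyConjGAt (mGt : EpsOrbitalMeasureFamily (epsLoc L Φ v) ⊥) (φ β : GtLoc L v → ℂ)
    (hβ : ∀ δ δ', IsStablyEpsConjAt L Φ v δ δ' → β δ = β δ')
    {sec₀ : (UnitaryGroup.cmDatum L 3 (Φ : Matrix (Fin 3) (Fin 3) L)).Local v → GtLoc L v} (hsec : ∀ γ, IsEpsNormPair L Φ v (sec₀ γ) γ)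
    {γ γ' : (UnitaryGroup.cmDatum L 3 (Φ : Matrix (Fin 3) (Fin 3) L)).Local v} (hst : IsStablyConjGAt L Φ v γ γ') :
    stableEpsOrbitalIntegral L Φ v mGt φ (sec₀ γ) * β (sec₀ γ) = stableEpsOrbitalIntegral L Φ v mGt φ (sec₀ γ') * β (sec₀ γ') := by
  have h : IsStablyEpsConjAt L Φ v (sec₀ γ) (sec₀ γ') := isStablyEpsConjAt_normSection_of_isStablyConjGAt hsec hst
  rw [stableEpsOrbitalIntegral_congr_of_isStablyEpsConjAt h mGt φ, hβ _ _ h]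

/-- **`E`-valued variant**: `γ ∼_{st} γ′ ⇒ Φ^{st}_ε(sec₀ γ, φ) • b(sec₀ γ) = Φ^{st}_ε(sec₀ γ′, φ) • b(sec₀ γ′)` for an ε-stable `b : G̃_v → E`.
[cite: Rogawski1990, §12.5 p. 186; §3.11 Prop. 3.11.1 (c) p. 34] -/
theorem stableEpsOrbitalIntegral_smul_eq_of_isStablyConjGAt (mGt : EpsOrbitalMeasureFamily (epsLoc L Φ v) ⊥) (φ : GtLoc L v → ℂ)
    {E : Type*} [AddCommGroup E] [Module ℂ E] (b : GtLoc L v → E) (hb : ∀ δ δ', IsStablyEpsConjAt L Φ v δ δ' → b δ = b δ')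
    {sec₀ : (UnitaryGroup.cmDatum L 3 (Φ : Matrix (Fin 3) (Fin 3) L)).Local v → GtLoc L v} (hsec : ∀ γ, IsEpsNormPair L Φ v (sec₀ γ) γ)
    {γ γ' : (UnitaryGroup.cmDatum L 3 (Φ : Matrix (Fin 3) (Fin 3) L)).Local v} (hst : IsStablyConjGAt L Φ v γ γ') :
    stableEpsOrbitalIntegral L Φ v mGt φ (sec₀ γ) • b (sec₀ γ) = stableEpsOrbitalIntegral L Φ v mGt φ (sec₀ γ') • b (sec₀ γ') := by
  have h : IsStablyEpsConjAt L Φ v (sec₀ γ) (sec₀ γ') := isStablyEpsConjAt_normSection_of_isStablyConjGAt hsec hst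
  rw [stableEpsOrbitalIntegral_congr_of_isStablyEpsConjAt h mGt φ, hb _ _ h]

end Generic

/-! ## §2 At the form of record `Φ := splitFormGL L` on `G_v = Gqs L v`: the `hG` row of ★ `setIntegral_cartanWeight_smul_eq_of_transport`, and the transport itself -/

section Record

variable (L : Type) [Field L] [NumberField L] [IsCMField L] (v : HeightOneSpectrum (𝓞 ↥(maximalRealSubfield L)))
  [∀ δ : GtLoc L v, MeasurableSpace (GtLoc L v ⧸ epsCentralizer (epsLoc L (splitFormGL L) v) δ)]

/-- **THE `hG` LETTER OF ★ `setIntegral_cartanWeight_smul_eq_of_transport` FOR `G := fun γ => Φ^{st}_ε(sec₀ γ, φ) * β(sec₀ γ)`** — binder shape VERBATIM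
(★ p863911 :166: `∀ γ γ' : Gqs L v, IsStablyConjGAt L (R90.S4.splitFormGL L) v γ γ' → G γ = G γ'`), carrier `Gqs L v`, form `splitFormGL L`; `β` ε-stable, `sec₀` an
everywhere-norm section. [cite: Rogawski1990, §12.5 p. 186; §3.11 Prop. 3.11.1 (c) p. 34; §4.10 (4.10.1) p. 57] -/
theorem stableEpsOrbitalIntegral_mul_eq_of_isStablyConjGAt_gqs (mGt : EpsOrbitalMeasureFamily (epsLoc L (splitFormGL L) v) ⊥) (φ β : GtLoc L v → ℂ)
    (hβ : ∀ δ δ', IsStablyEpsConjAt L (splitFormGL L) v δ δ' → β δ = β δ')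
    (sec₀ : Gqs L v → GtLoc L v) (hsec : ∀ γ : Gqs L v, IsEpsNormPair L (splitFormGL L) v (sec₀ γ) γ) :
    ∀ γ γ' : Gqs L v, IsStablyConjGAt L (R90.S4.splitFormGL L) v γ γ' →
      stableEpsOrbitalIntegral L (splitFormGL L) v mGt φ (sec₀ γ) * β (sec₀ γ) = stableEpsOrbitalIntegral L (splitFormGL L) v mGt φ (sec₀ γ') * β (sec₀ γ') :=
  fun _ _ hst => stableEpsOrbitalIntegral_mul_eq_of_isStablyConjGAt (Φ := splitFormGL L) mGt φ β hβ hsec hst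

/-- **`E`-valued `•` variant of the `hG` letter** for `G := fun γ => Φ^{st}_ε(sec₀ γ, φ) • b(sec₀ γ)`. [cite: Rogawski1990, §12.5 p. 186; §3.11 Prop. 3.11.1 (c) p. 34] -/
theorem stableEpsOrbitalIntegral_smul_eq_of_isStablyConjGAt_gqs (mGt : EpsOrbitalMeasureFamily (epsLoc L (splitFormGL L) v) ⊥) (φ : GtLoc L v → ℂ)
    {E : Type*} [AddCommGroup E] [Module ℂ E] (b : GtLoc L v → E) (hb : ∀ δ δ', IsStablyEpsConjAt L (splitFormGL L) v δ δ' → b δ = b δ')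
    (sec₀ : Gqs L v → GtLoc L v) (hsec : ∀ γ : Gqs L v, IsEpsNormPair L (splitFormGL L) v (sec₀ γ) γ) :
    ∀ γ γ' : Gqs L v, IsStablyConjGAt L (R90.S4.splitFormGL L) v γ γ' →
      stableEpsOrbitalIntegral L (splitFormGL L) v mGt φ (sec₀ γ) • b (sec₀ γ) = stableEpsOrbitalIntegral L (splitFormGL L) v mGt φ (sec₀ γ') • b (sec₀ γ') :=
  fun _ _ hst => stableEpsOrbitalIntegral_smul_eq_of_isStablyConjGAt (Φ := splitFormGL L) mGt φ b hb hsec hst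

/-- **TRANSPORT OF THE TWISTED TORUS INTEGRAND TO A STABLY CONJUGATE CARTAN MEMBER** — ★ `setIntegral_cartanWeight_smul_eq_of_transport` (p863911 :160) with its `hG`
letter DISCHARGED for `G γ := Φ^{st}_ε(sec₀ γ, φ) · β(sec₀ γ)`: with the transport data `(hT′, e, he, hw, tT, tT′, htc, htc′)` of ★ VERBATIM (non-split `v`),
`∫_{T′^{reg}} D_{T′}(t) • (Φ^{st}_ε(sec₀ t, φ) β(sec₀ t)) dt_{T′} = ∫_{T^{reg}} D_T(t) • (Φ^{st}_ε(sec₀ t, φ) β(sec₀ t)) dt_T` — the (B1-Σ) step «move every member to its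
representative». [cite: Rogawski1990, §12.5 pp. 182, 186; §4.3 (4.3.1) p. 43; §3.11 Prop. 3.11.1 (c) p. 34] -/
theorem setIntegral_cartanWeight_smul_stableEpsOrbitalIntegral_mul_eq_of_transport
    (hns : ∀ w : PlacesOver L v, IsCMField.complexConj L • w.1 = w.1)
    [MeasurableSpace (Gqs L v)] [BorelSpace (Gqs L v)] {T T' : Subgroup (Gqs L v)} (hT' : IsClosed (T' : Set (Gqs L v)))
    (e : ↥T ≃ₜ* ↥T') (he : ∀ t : ↥T, IsStablyConjGAt L (R90.S4.splitFormGL L) v (t : Gqs L v) ((e t : ↥T') : Gqs L v))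
    (hw : ∀ t : ↥T, IsRegularElt (((t : Gqs L v)).val : GL (Fin 3) (LocalRing L v)) → cartanWeight L v T' (e t) = cartanWeight L v T t)
    (tT : Measure ↥T) [tT.IsHaarMeasure] (tT' : Measure ↥T') [tT'.IsHaarMeasure] (htc : tT (compactCore ↥T) = 1) (htc' : tT' (compactCore ↥T') = 1)
    (mGt : EpsOrbitalMeasureFamily (epsLoc L (splitFormGL L) v) ⊥) (φ β : GtLoc L v → ℂ)
    (hβ : ∀ δ δ', IsStablyEpsConjAt L (splitFormGL L) v δ δ' → β δ = β δ')
    (sec₀ : Gqs L v → GtLoc L v) (hsec : ∀ γ : Gqs L v, IsEpsNormPair L (splitFormGL L) v (sec₀ γ) γ) :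
    ∫ t in {t : ↥T' | IsRegularElt (((t : Gqs L v)).val : GL (Fin 3) (LocalRing L v))},
        (cartanWeight L v T' t : ℝ) • (stableEpsOrbitalIntegral L (splitFormGL L) v mGt φ (sec₀ (t : Gqs L v)) * β (sec₀ (t : Gqs L v))) ∂tT' =
      ∫ t in {t : ↥T | IsRegularElt (((t : Gqs L v)).val : GL (Fin 3) (LocalRing L v))},
        (cartanWeight L v T t : ℝ) • (stableEpsOrbitalIntegral L (splitFormGL L) v mGt φ (sec₀ (t : Gqs L v)) * β (sec₀ (t : Gqs L v))) ∂tT :=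
  setIntegral_cartanWeight_smul_eq_of_transport L v hns hT' e he hw tT tT' htc htc'
    (fun γ => stableEpsOrbitalIntegral L (splitFormGL L) v mGt φ (sec₀ γ) * β (sec₀ γ))
    (stableEpsOrbitalIntegral_mul_eq_of_isStablyConjGAt_gqs L v mGt φ β hβ sec₀ hsec)

end Record

end Summit.HodgeConjecture.HodgeConjecture.R90.S4

end
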